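import Summits.BirchSwinnertonDyer.BirchSwinnertonDyer.Theorems.GenusKolyvaginAtTwoGenusPrimitiveSupplyAtTwoGenusReduction
import Literature.NumberTheory.EllipticCurves.HeegnerPointsOfConductorRationalityProofs
import Literature.NumberTheory.EllipticCurves.RingClassFieldAbelian
import Literature.NumberTheory.QuadraticFields.FundamentalDiscriminant

/-!
# Route `GenusKolyvaginAtTwo`, crux `GenusPrimitiveSupplyAtTwo` (stmt-BirchSwinnertonDyer-22136), line `genus-supply`:
# the GENUS REDUCTION at ANY square-free level of Kolyvagin primes at `2` — `P(n) ≡ G⁺(n) (mod 2E(K[n]))`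

Sequel of `…GenusIdentity.lean` §4 (`P(n) ≡ G(n) (mod 2A)`, `G(n) = Σ_{s∈S} s(∏_{ℓ∣n} Σ_{i odd ≤ ℓ} σ_ℓ^i · y(n))`) and
`…GenusReduction.lean` (the prime level). On WALL row 1 a single Kolyvagin prime need not suffice (McCallum: the first
level `r` with `ord₂ P(n) = 0` is the number of pairs of elementary divisors of `Ш(E/K)[2^∞]`, e.g. `r = 2` for
`(ℤ/2)^4`), so the registered stub C quantifies over square-free `n`; this file gives the mod-`2` dictionary there.
With `σ_ℓ` (`ℓ ∣ n`) the generators of the `G_ℓ = Gal(K[n]/K[n/ℓ])` — which COMMUTE (`𝒢_n = Gal(K[n]/K)` is abelian: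
tree `commute_of_mem_ringClassGal`, Cox §9.A) — and `E_ℓ = Σ_{i even ≤ ℓ} σ_ℓ^i` (`= N_{⟨σ_ℓ²⟩}`, the norm to the
quadratic «genus» layer of `K[n]/K[n/ℓ]`), `T_ℓ = Σ_{i ≤ ℓ} σ_ℓ^i = Tr_{G_ℓ}`:
`∏ O_ℓ = ∏ (T_ℓ − E_ℓ) ≡ ± ∏ E_ℓ (mod 2A)` as soon as every `T_ℓ y(n) ∈ 2A` — and `T_ℓ y(n) = a_ℓ · y(n/ℓ)` (Gross Prop.
3.7 (1), tree `HeegnerTrace.finsum_mem_ringClassGalOver_eq_frobeniusTrace_smul`) IS in `2E(K[n])` for a Kolyvagin prime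
at `2` (`2 ∣ a_ℓ`; `y(n/ℓ) ∈ E(K[n/ℓ]) ⊆ E(K[n])` by the PROVED rationality
`phi_heegnerPointOfConductor_mem_range_map_ringClassField_holds` and the tower `ringClassField_mono`). Hence
  `P(n) ∈ 2E(K[n]) ⟺ G⁺(n) := Σ_{s∈S} s(∏_{ℓ∣n} E_ℓ · y(n)) ∈ 2E(K[n])`
(`heegner_exists_two_zsmul_eq_derivedPoint_iff_evenPart_of_kolyvagin`): Kolyvagin `2`-primitivity at level `n` IS the
`2`-primitivity of the MULTI-GENUS Heegner point `G⁺(n)` — the trace of `y(n)` to the compositum of `K[1]` with the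
quadratic layers of the `K[n]/K[n/ℓ]` (the field `K[1](√ℓ₁*, …, √ℓ_r*)`), summed over the coset representatives `S`.
This is the route's child U («odd Heegner index of a genus pair») at every level, and the form in which the Birch–Heegner
∕ Coates–Li–Tian–Zhai ∕ Shu–Zhai (arXiv:2102.11808) «generalized Birch lemma» inductions on the number of prime factors
are phrased (there for curves WITH rational `2`-torsion; the habitat here has `ρ̄_{E,2}` onto).
* §1 (abstract): `evenPart_add`, `evenPart_zsmul`, `sum_pow_evenPart_comm`, `exists_oddPart_eq_evenPart_add_two_zsmul`,
  `exists_two_zsmul_eq_derivedPoint_iff_evenPart`.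
* §2 (Heegner data of square-free conductor `n`): commuting generators, `orderOf σ_ℓ = ℓ + 1`, `G_ℓ = {σ_ℓ^i}`, the trace
  `T_ℓ y(n) = a_ℓ · y(n/ℓ)'` in `E(K[n])`, and the reduction for Kolyvagin primes at `2`.
* §3 (APPEND 1): `d_K` odd `≠ −3` ⟹ `d_K < −4`; the two forms of stub C («some `P(n) ∉ 2E(K[n])`» ∕ «some multi-genus
  `G⁺(n) ∉ 2E(K[n])`») are equivalent frame by frame (`exists_derivedPoint_not_two_dvd_of_multiGenus` and converse).
* §4 (APPEND 2): the level-`1` case (`M₀ = 0` ⟹ stub C at `n = 1`) and the `M₀`-dichotomy per frame.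
Helper for the crux item (`--supports stmt-BirchSwinnertonDyer-22136`, helper mode). No summit and no leaf is proved
by this file; BSD is not proved by any of this.
-/

set_option linter.dupNamespace false -- tree convention: `Summit.BirchSwinnertonDyer.BirchSwinnertonDyer.Theorems` (summit = sub-problem)

noncomputable section

open scoped Classical

namespace Summit.BirchSwinnertonDyer.BirchSwinnertonDyer.Theorems.GenusKoly

open Finset NumberField WeierstrassCurve Literature.NumberTheory.EllipticCurves
  Literature.NumberTheory.EllipticCurves.ModularForms Literature.NumberTheory.EllipticCurves.KolyvaginOperator

/-! ## §1 The reduction at a composite level, for a monoid acting on an additive group -/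

section Operator

variable {G : Type*} [Monoid G] {A : Type*} [AddCommGroup A] (ρ : G →* AddMonoid.End A)

/-- The even-part operator `∏_{ℓ∈L} E_ℓ`, `E_ℓ = Σ_{i even ≤ ℓ} σ_ℓ^i` (as a `List.foldr`), is additive. [folklore] -/
theorem evenPart_add (σ : ℕ → G) (L : List ℕ) (x x' : A) :
    L.foldr (fun ℓ x ↦ ∑ i ∈ (range (ℓ + 1)).filter (fun i ↦ ¬ Odd i), ρ (σ ℓ ^ i) x) (x + x') =
      L.foldr (fun ℓ x ↦ ∑ i ∈ (range (ℓ + 1)).filter (fun i ↦ ¬ Odd i), ρ (σ ℓ ^ i) x) x +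
        L.foldr (fun ℓ x ↦ ∑ i ∈ (range (ℓ + 1)).filter (fun i ↦ ¬ Odd i), ρ (σ ℓ ^ i) x) x' := by
  induction L with
  | nil => rfl
  | cons ℓ L ih => simp only [List.foldr_cons, ih, map_add, Finset.sum_add_distrib]

/-- The even-part operator commutes with integer scalars. [folklore] -/
theorem evenPart_zsmul (σ : ℕ → G) (L : List ℕ) (m : ℤ) (x : A) :
    L.foldr (fun ℓ x ↦ ∑ i ∈ (range (ℓ + 1)).filter (fun i ↦ ¬ Odd i), ρ (σ ℓ ^ i) x) (m • x) =
      m • L.foldr (fun ℓ x ↦ ∑ i ∈ (range (ℓ + 1)).filter (fun i ↦ ¬ Odd i), ρ (σ ℓ ^ i) x) x := by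
  induction L with
  | nil => rfl
  | cons ℓ L ih => simp only [List.foldr_cons, ih, map_zsmul, Finset.smul_sum]

/-- A sum of powers of `τ` commutes with the even-part operator of `L` when `τ` commutes with every `σ_ℓ'`, `ℓ' ∈ L`
(the `G_ℓ` commute inside the abelian `𝒢_n`; Gross 1991 §3 `G_n ≃ ∏ G_ℓ`). [cite: GrossLMS1991, §3 (G_n = ∏ G_ℓ)] -/
theorem sum_pow_evenPart_comm (σ : ℕ → G) (τ : G) (I : Finset ℕ) (L : List ℕ)
    (hcomm : ∀ ℓ' ∈ L, Commute τ (σ ℓ')) (x : A) :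
    ∑ i ∈ I, ρ (τ ^ i) (L.foldr (fun ℓ x ↦ ∑ i ∈ (range (ℓ + 1)).filter (fun i ↦ ¬ Odd i), ρ (σ ℓ ^ i) x) x) =
      L.foldr (fun ℓ x ↦ ∑ i ∈ (range (ℓ + 1)).filter (fun i ↦ ¬ Odd i), ρ (σ ℓ ^ i) x)
        (∑ i ∈ I, ρ (τ ^ i) x) := by
  induction L generalizing x with
  | nil => rfl
  | cons ℓ L ih =>
    have hL : ∀ ℓ' ∈ L, Commute τ (σ ℓ') := fun ℓ' h ↦ hcomm ℓ' (List.mem_cons_of_mem ℓ h)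
    simp only [List.foldr_cons]
    rw [← ih hL]
    simp only [map_sum]
    rw [Finset.sum_comm]
    refine Finset.sum_congr rfl fun j _ ↦ Finset.sum_congr rfl fun i _ ↦ ?_
    have hc : Commute (τ ^ i) (σ ℓ ^ j) := (hcomm ℓ List.mem_cons_self).pow_pow i j
    change (ρ (τ ^ i) * ρ (σ ℓ ^ j)) _ = (ρ (σ ℓ ^ j) * ρ (τ ^ i)) _
    rw [← map_mul, ← map_mul, hc.eq]

/-- **`∏ O_ℓ ≡ ∏ E_ℓ (mod 2A)` on `y`** — the odd-part operator `∏_{ℓ∈L} Σ_{i odd ≤ ℓ} σ_ℓ^i` and the even-part operator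
`∏_{ℓ∈L} Σ_{i even ≤ ℓ} σ_ℓ^i` agree on `y` modulo `2A`, provided the `σ_ℓ` (`ℓ ∈ L`) commute pairwise and every trace
`T_ℓ y = Σ_{i≤ℓ} σ_ℓ^i y` lies in `2A`: induction on `L` with `O_ℓ = T_ℓ − E_ℓ`, `T_ℓ(∏E · y) = ∏E (T_ℓ y) ∈ 2A` by
commutation. [cite: GrossLMS1991, §3 (3.5), Prop. 3.7 (1)] -/
theorem exists_oddPart_eq_evenPart_add_two_zsmul (σ : ℕ → G) (L : List ℕ) (y : A)
    (hcomm : ∀ ℓ ∈ L, ∀ ℓ' ∈ L, Commute (σ ℓ) (σ ℓ'))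
    (htr : ∀ ℓ ∈ L, ∃ w : A, (2 : ℤ) • w = ∑ i ∈ range (ℓ + 1), ρ (σ ℓ ^ i) y) :
    ∃ z : A, L.foldr (fun ℓ x ↦ ∑ i ∈ (range (ℓ + 1)).filter Odd, ρ (σ ℓ ^ i) x) y =
      L.foldr (fun ℓ x ↦ ∑ i ∈ (range (ℓ + 1)).filter (fun i ↦ ¬ Odd i), ρ (σ ℓ ^ i) x) y + (2 : ℤ) • z := by
  induction L with
  | nil => exact ⟨0, by simp⟩
  | cons ℓ L ih =>
    have hcommL : ∀ ℓ₁ ∈ L, ∀ ℓ₂ ∈ L, Commute (σ ℓ₁) (σ ℓ₂) := fun ℓ₁ h₁ ℓ₂ h₂ ↦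
      hcomm ℓ₁ (List.mem_cons_of_mem ℓ h₁) ℓ₂ (List.mem_cons_of_mem ℓ h₂)
    have htrL : ∀ ℓ' ∈ L, ∃ w : A, (2 : ℤ) • w = ∑ i ∈ range (ℓ' + 1), ρ (σ ℓ' ^ i) y := fun ℓ' h ↦
      htr ℓ' (List.mem_cons_of_mem ℓ h)
    obtain ⟨z, hz⟩ := ih hcommL htrL
    obtain ⟨w, hw⟩ := htr ℓ List.mem_cons_self
    set E := L.foldr (fun ℓ x ↦ ∑ i ∈ (range (ℓ + 1)).filter (fun i ↦ ¬ Odd i), ρ (σ ℓ ^ i) x) y with hE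
    have htrE : ∑ i ∈ range (ℓ + 1), ρ (σ ℓ ^ i) E =
        (2 : ℤ) • L.foldr (fun ℓ x ↦ ∑ i ∈ (range (ℓ + 1)).filter (fun i ↦ ¬ Odd i), ρ (σ ℓ ^ i) x) w := by
      rw [hE, sum_pow_evenPart_comm ρ σ (σ ℓ) (range (ℓ + 1)) L
        (fun ℓ' h ↦ hcomm ℓ List.mem_cons_self ℓ' (List.mem_cons_of_mem ℓ h)) y, ← hw, evenPart_zsmul]
    refine ⟨L.foldr (fun ℓ x ↦ ∑ i ∈ (range (ℓ + 1)).filter (fun i ↦ ¬ Odd i), ρ (σ ℓ ^ i) x) w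
      - (∑ i ∈ (range (ℓ + 1)).filter (fun i ↦ ¬ Odd i), ρ (σ ℓ ^ i) E)
      + ∑ i ∈ (range (ℓ + 1)).filter Odd, ρ (σ ℓ ^ i) z, ?_⟩
    rw [List.foldr_cons, List.foldr_cons, hz]
    simp only [map_add, map_zsmul, Finset.sum_add_distrib, ← Finset.smul_sum]
    have hsplit := Finset.sum_filter_add_sum_filter_not (range (ℓ + 1)) Odd (fun i ↦ ρ (σ ℓ ^ i) E)
    rw [htrE] at hsplit
    rw [← hE]
    linear_combination (norm := module) hsplit

/-- **`P(n) ∈ 2A ⟺ G⁺(n) ∈ 2A`, abstract form**: for commuting `σ_ℓ` (`ℓ ∣ n`) with `2`-divisible traces `T_ℓ y`,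
the derived point `P(n) = Σ_{s∈S} s(D_n y)` (Gross 1991 (4.1)) is in `2A` iff the even-part («multi-genus») point
`G⁺(n) = Σ_{s∈S} s(∏_{ℓ∣n} Σ_{i even ≤ ℓ} σ_ℓ^i · y)` is. (`…GenusIdentity` §4 + `exists_oddPart_eq_evenPart_add_two_zsmul`.)
[cite: GrossLMS1991, §3 (3.5), Prop. 3.7 (1), §4 (4.1)] -/
theorem exists_two_zsmul_eq_derivedPoint_iff_evenPart (σ : ℕ → G) (n : ℕ) (S : Finset G) (y : A)
    (hcomm : ∀ ℓ ∈ n.primeFactorsList, ∀ ℓ' ∈ n.primeFactorsList, Commute (σ ℓ) (σ ℓ'))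
    (htr : ∀ ℓ ∈ n.primeFactorsList, ∃ w : A, (2 : ℤ) • w = ∑ i ∈ range (ℓ + 1), ρ (σ ℓ ^ i) y) :
    (∃ Q : A, (2 : ℤ) • Q = derivedPoint ρ σ n S y) ↔
      ∃ Q : A, (2 : ℤ) • Q = ∑ s ∈ S, ρ s
        (n.primeFactorsList.foldr (fun ℓ x ↦ ∑ i ∈ (range (ℓ + 1)).filter (fun i ↦ ¬ Odd i), ρ (σ ℓ ^ i) x) y) := by
  rw [exists_two_zsmul_eq_derivedPoint_iff_oddPart]
  obtain ⟨z, hz⟩ := exists_oddPart_eq_evenPart_add_two_zsmul ρ σ n.primeFactorsList y hcomm htr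
  have hsum : ∑ s ∈ S, ρ s (n.primeFactorsList.foldr (fun ℓ x ↦ ∑ i ∈ (range (ℓ + 1)).filter Odd, ρ (σ ℓ ^ i) x) y) =
      ∑ s ∈ S, ρ s (n.primeFactorsList.foldr
        (fun ℓ x ↦ ∑ i ∈ (range (ℓ + 1)).filter (fun i ↦ ¬ Odd i), ρ (σ ℓ ^ i) x) y) +
        (2 : ℤ) • ∑ s ∈ S, ρ s z := by
    rw [hz, Finset.smul_sum, ← Finset.sum_add_distrib]
    exact Finset.sum_congr rfl fun s _ ↦ by rw [map_add, map_zsmul]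
  rw [hsum]
  constructor
  · rintro ⟨Q, hQ⟩
    exact ⟨Q - ∑ s ∈ S, ρ s z, by rw [smul_sub, hQ, add_sub_cancel_right]⟩
  · rintro ⟨Q, hQ⟩
    exact ⟨Q + ∑ s ∈ S, ρ s z, by rw [smul_add, hQ]⟩

end Operator

/-! ## §2 The tree's Heegner data of square-free conductor -/

section Heegner

variable {W : WeierstrassCurve ℚ} [NeZero (W.conductorNorm ℤ)] {K : Type} [Field K] [NumberField K]
  {Dt : ModularParametrizationData W (W.conductorNorm ℤ)} {β : ℤ} {ι : K →+* ℂ}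

/-- `σ_ℓ ∈ 𝒢_n` for `ℓ ∣ n` (it generates `G_ℓ = Gal(K[n]/K[n/ℓ]) ≤ Gal(K[n]/K)`). [cite: GrossLMS1991, §3 (G_ℓ, σ_ℓ)] -/
theorem heegner_sigma_pow_mem_ringClassGal {n : ℕ} (d : KolyvaginHeegnerData Dt β ι n) {ℓ : ℕ}
    (hℓ : ℓ ∈ n.primeFactors) (i : ℕ) : d.σ ℓ ^ i ∈ ringClassGal ι n := by
  refine ringClassGalOver_le_ringClassGal ι n (n / ℓ) ?_
  rw [← d.zpowers_σ ℓ hℓ]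
  exact Subgroup.npow_mem_zpowers _ i

/-- **The generators `σ_ℓ`, `σ_ℓ'` (`ℓ, ℓ' ∣ n`) commute**: `𝒢_n = Gal(K[n]/K)` is abelian (Cox §9.A; tree
`commute_of_mem_ringClassGal`). [cite: Cox2013, §9.A (pp. 180–181)] [cite: GrossLMS1991, §3 (G_n ≃ ∏ G_ℓ)] -/
theorem heegner_commute_sigma (hK : IsImaginaryQuadratic K) {n : ℕ} (hn : n ≠ 0) (d : KolyvaginHeegnerData Dt β ι n)
    {ℓ ℓ' : ℕ} (hℓ : ℓ ∈ n.primeFactors) (hℓ' : ℓ' ∈ n.primeFactors) : Commute (d.σ ℓ) (d.σ ℓ') := by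
  have h1 := heegner_sigma_pow_mem_ringClassGal d hℓ 1
  have h2 := heegner_sigma_pow_mem_ringClassGal d hℓ' 1
  rw [pow_one] at h1 h2
  exact commute_of_mem_ringClassGal hK hn h1 h2

/-- **`σ_ℓ` has order `ℓ + 1` at a square-free level `n`** (`ℓ ∣ n` inert in `K`, `d_K < −4`; Gross §3 «`G_ℓ` cyclic of
order `ℓ + 1`»; x11b3's `orderOf_eq_succ_of_zpowers_eq_ringClassGalOver`). [cite: GrossLMS1991, §3 (G_ℓ, σ_ℓ)] -/
theorem heegner_orderOf_sigma_of_squarefree (hK : IsImaginaryQuadratic K) (hD : NumberField.discr K < -4) {n : ℕ}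
    (hn : Squarefree n) (d : KolyvaginHeegnerData Dt β ι n) {ℓ : ℕ} (hℓ : ℓ ∈ n.primeFactors)
    (hinert : (Ideal.span {(ℓ : 𝓞 K)}).IsPrime) : orderOf (d.σ ℓ) = ℓ + 1 := by
  have hℓp : ℓ.Prime := Nat.prime_of_mem_primeFactors hℓ
  have hℓn : ℓ ∣ n := Nat.dvd_of_mem_primeFactors hℓ
  have hℓn' : ¬ ℓ ∣ n / ℓ := fun h ↦ by
    have : ℓ * ℓ ∣ n := by
      have := Nat.mul_dvd_mul_left ℓ h
      rwa [Nat.mul_div_cancel' hℓn] at this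
    exact hℓp.not_isUnit (hn ℓ this)
  exact Summit.BirchSwinnertonDyer.Rank1Residual.X11b.RingClassTower.orderOf_eq_succ_of_zpowers_eq_ringClassGalOver
    hK ι hℓp hinert hℓn hℓn' hn.ne_zero (Or.inr hD) (d.zpowers_σ ℓ hℓ)

/-- **`G_ℓ = {σ_ℓ^i : i ≤ ℓ}`** at a square-free level. [cite: GrossLMS1991, §3 (G_ℓ, σ_ℓ)] -/
theorem heegner_coe_ringClassGalOver_div_eq_image_pow (hK : IsImaginaryQuadratic K) (hD : NumberField.discr K < -4)
    {n : ℕ} (hn : Squarefree n) (d : KolyvaginHeegnerData Dt β ι n) {ℓ : ℕ} (hℓ : ℓ ∈ n.primeFactors)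
    (hinert : (Ideal.span {(ℓ : 𝓞 K)}).IsPrime) :
    (ringClassGalOver ι n (n / ℓ) : Set (ringClassField K ι n ≃ₐ[ℚ] ringClassField K ι n)) =
      ↑((range (ℓ + 1)).image (d.σ ℓ ^ ·)) := by
  have hord := heegner_orderOf_sigma_of_squarefree hK hD hn d hℓ hinert
  have hfin : IsOfFinOrder (d.σ ℓ) := orderOf_pos_iff.mp (by rw [hord]; exact Nat.succ_pos ℓ)
  ext g
  rw [SetLike.mem_coe, ← d.zpowers_σ ℓ hℓ, hfin.mem_zpowers_iff_mem_range_orderOf, hord, Finset.mem_coe]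

/-- **`T_ℓ y(n) = a_ℓ · y(n/ℓ)'` in `E(K[n])`** (Gross 1991 Prop. 3.7 (1) «`Tr_ℓ y_n = a_ℓ y_{n/ℓ}`»; the tree's DISCHARGED
`HeegnerTrace.finsum_mem_ringClassGalOver_eq_frobeniusTrace_smul` at `(n, n/ℓ)`, read back from `E(ℂ)` into `E(K[n])`, with
`y(n/ℓ)' ∈ E(K[n])` the image of the `K[n/ℓ]`-rational point over `x(n/ℓ)` — PROVED rationality
`phi_heegnerPointOfConductor_mem_range_map_ringClassField_holds`, tower `ringClassField_mono`): for `K` imaginary quadratic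
with the Heegner hypothesis and `d_K < −4`, `n` square-free with every prime factor inert and prime to `N_E`, `ℓ ∣ n`.
[cite: GrossLMS1991, §3 Prop. 3.7 (1)] -/
theorem heegner_sum_pow_sigma_eq_frobeniusTrace_zsmul_of_squarefree [W.IsElliptic] [W.IsGloballyMinimal]
    (hK : IsImaginaryQuadratic K) (hD : NumberField.discr K < -4)
    (hH : SatisfiesHeegnerHypothesis (W.conductorNorm ℤ) K) {n : ℕ} (hn : Squarefree n)
    (hinert : ∀ q ∈ n.primeFactors, (Ideal.span {(q : 𝓞 K)}).IsPrime) (hN : ∀ q ∈ n.primeFactors, ¬ q ∣ W.conductorNorm ℤ)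
    (d : KolyvaginHeegnerData Dt β ι n) {ℓ : ℕ} (hℓ : ℓ ∈ n.primeFactors) :
    ∃ y₁ : (W.baseChange (ringClassField K ι n)).toAffine.Point,
      WeierstrassCurve.Affine.Point.map (W' := W) (ringClassField K ι n).subtype.toRatAlgHom y₁ =
        heegnerPointComplexOfConductor Dt (NumberField.discr K) β (n / ℓ) ∧
      ∑ i ∈ range (ℓ + 1), pointGalHom W (ringClassField K ι n) (d.σ ℓ ^ i) d.y = (W.frobeniusTrace ℓ) • y₁ := by
  have hn0 : n ≠ 0 := hn.ne_zero
  have hℓp : ℓ.Prime := Nat.prime_of_mem_primeFactors hℓ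
  have hℓn : ℓ ∣ n := Nat.dvd_of_mem_primeFactors hℓ
  set m := n / ℓ with hm_def
  have hmn : ℓ * m = n := Nat.mul_div_cancel' hℓn
  have hm0 : m ≠ 0 := fun h ↦ hn0 (by rw [← hmn, h, mul_zero])
  have hℓm : ¬ ℓ ∣ m := fun h ↦ by
    have : ℓ * ℓ ∣ n := by rw [← hmn]; exact Nat.mul_dvd_mul_left ℓ h
    exact hℓp.not_isUnit (hn ℓ this)
  have hmdvd : m ∣ n := Dvd.intro_left ℓ hmn
  -- coprimality with the level
  have hcopn : Nat.Coprime n (W.conductorNorm ℤ) :=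
    Nat.coprime_of_dvd fun k hk hkn hkN ↦ hN k (Nat.mem_primeFactors.mpr ⟨hk, hkn, hn0⟩) hkN
  have hNm : Nat.Coprime (W.conductorNorm ℤ) m := (Nat.Coprime.coprime_dvd_left hmdvd hcopn).symm
  have hND : IsCoprime (W.conductorNorm ℤ : ℤ) (NumberField.discr K) := by
    have h := Literature.SatisfiesHeegnerHypothesis.coprime_discr hK.1 hH
    refine Int.isCoprime_iff_gcd_eq_one.mpr ?_
    rw [Int.gcd_eq_natAbs, Int.natAbs_natCast]
    exact h
  -- `y(m)' ∈ E(K[n])` over `x(m)`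
  obtain ⟨y₀, hy₀⟩ := phi_heegnerPointOfConductor_mem_range_map_ringClassField_holds (W.conductorNorm ℤ) W K hK hH Dt β ι
    m d.dvd_sq_sub hm0 hNm.symm
  have hle : ringClassField K ι m ≤ ringClassField K ι n := ringClassField_mono hK ι hmdvd hn0
  set y₁ := WeierstrassCurve.Affine.Point.map (W' := W) (Subfield.inclusion hle).toRatAlgHom y₀ with hy₁_def
  have hy₁ : WeierstrassCurve.Affine.Point.map (W' := W) (ringClassField K ι n).subtype.toRatAlgHom y₁ =
      heegnerPointComplexOfConductor Dt (NumberField.discr K) β m :=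
    (map_subtype_map_inclusion_eq hle W y₀).trans hy₀
  refine ⟨y₁, hy₁, ?_⟩
  -- the norm relation in `E(ℂ)`, reindexed over the powers of `σ_ℓ`
  have htr := HeegnerTrace.finsum_mem_ringClassGalOver_eq_frobeniusTrace_smul hK ι Dt hND d.dvd_sq_sub hℓp (hinert ℓ hℓ)
    (hN ℓ hℓ) hℓm hm0 hNm (Or.inr hD) hmn d.map_y
  have hord := heegner_orderOf_sigma_of_squarefree hK hD hn d hℓ (hinert ℓ hℓ)
  have hinj : Set.InjOn (d.σ ℓ ^ ·) (range (ℓ + 1) : Finset ℕ) := by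
    intro i hi j hj hij
    exact pow_injOn_Iio_orderOf (x := d.σ ℓ) (by rw [Set.mem_Iio, hord]; exact Finset.mem_range.mp hi)
      (by rw [Set.mem_Iio, hord]; exact Finset.mem_range.mp hj) hij
  rw [heegner_coe_ringClassGalOver_div_eq_image_pow hK hD hn d hℓ (hinert ℓ hℓ), finsum_mem_coe_finset,
    Finset.sum_image hinj] at htr
  apply WeierstrassCurve.Affine.Point.map_injective (W' := W) (ringClassField K ι n).subtype.toRatAlgHom
  rw [map_sum, htr, map_zsmul, hy₁]

/-- **THE GENUS REDUCTION AT ANY SQUARE-FREE LEVEL OF KOLYVAGIN PRIMES AT `2`.** For `E/ℚ` (globally minimal `W`), `K`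
imaginary quadratic with the Heegner hypothesis and `d_K < −4`, `n` square-free all of whose prime factors are
Kolyvagin primes at `2` (`Zhang2014.IsKolyvaginPrime N_E W K 2 ℓ`: `ℓ ∤ N_E d_K`, inert, `2 ∣ ℓ + 1`, `2 ∣ a_ℓ`), and the
tree's datum `d` of conductor `n`:
  `P(n) ∈ 2E(K[n]) ⟺ G⁺(n) = Σ_{s∈S} s(∏_{ℓ∣n} Σ_{i even ≤ ℓ} σ_ℓ^i · y(n)) ∈ 2E(K[n])`.
So the registered stub C of line `genus-supply` («∃ n, d: `P(n) ∉ 2E(K[n])`») is EXACTLY «∃ n, d: the multi-genus point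
`G⁺(n) ∉ 2E(K[n])`». [cite: GrossLMS1991, §3 (3.3), (3.5), Prop. 3.7 (1), §4 (4.1)] [cite: WZhang2014, Notations (xii), §3.7] -/
theorem heegner_exists_two_zsmul_eq_derivedPoint_iff_evenPart_of_kolyvagin [W.IsElliptic] [W.IsGloballyMinimal]
    (hK : IsImaginaryQuadratic K) (hD : NumberField.discr K < -4)
    (hH : SatisfiesHeegnerHypothesis (W.conductorNorm ℤ) K) {n : ℕ} (hn : Squarefree n)
    (hKoly : ∀ ℓ ∈ n.primeFactors, Zhang2014.IsKolyvaginPrime (W.conductorNorm ℤ) W K 2 ℓ)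
    (d : KolyvaginHeegnerData Dt β ι n) :
    (∃ Q : (W.baseChange (ringClassField K ι n)).toAffine.Point, (2 : ℤ) • Q = d.derivedPoint) ↔
      ∃ Q : (W.baseChange (ringClassField K ι n)).toAffine.Point, (2 : ℤ) • Q =
        ∑ s ∈ d.S, pointGalHom W (ringClassField K ι n) s
          (n.primeFactorsList.foldr
            (fun ℓ x ↦ ∑ i ∈ (range (ℓ + 1)).filter (fun i ↦ ¬ Odd i),
              pointGalHom W (ringClassField K ι n) (d.σ ℓ ^ i) x) d.y) := by
  haveI : Fact (Nat.Prime 2) := ⟨Nat.prime_two⟩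
  have hinert : ∀ q ∈ n.primeFactors, (Ideal.span {(q : 𝓞 K)}).IsPrime := fun q hq ↦ (hKoly q hq).2.2.2.2.1
  have hN : ∀ q ∈ n.primeFactors, ¬ q ∣ W.conductorNorm ℤ := fun q hq ↦ (hKoly q hq).2.1
  refine exists_two_zsmul_eq_derivedPoint_iff_evenPart _ d.σ n d.S d.y ?_ ?_
  · intro ℓ hℓ ℓ' hℓ'
    exact heegner_commute_sigma hK hn.ne_zero d (List.mem_toFinset.mpr hℓ) (List.mem_toFinset.mpr hℓ')
  · intro ℓ hℓ
    have hℓ' : ℓ ∈ n.primeFactors := List.mem_toFinset.mpr hℓ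
    obtain ⟨y₁, -, hsum⟩ := heegner_sum_pow_sigma_eq_frobeniusTrace_zsmul_of_squarefree hK hD hH hn hinert hN d hℓ'
    obtain ⟨c, hc⟩ := (hKoly ℓ hℓ').dvd.2
    refine ⟨c • y₁, ?_⟩
    rw [hsum, hc, smul_smul]
    norm_num

/-! ### §3 (APPEND 1, same seat) In the binder frame of the registered stub C -/

/-- An imaginary quadratic field with ODD discriminant `≠ −3` has `d_K < −4` (odd fundamental discriminants are
`≡ 1 (mod 4)`: Stickelberger, tree `isFundamentalDiscriminant_discr`; the negative ones are `−3, −7, −11, …`) — so the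
crux's `Odd d_K`, `d_K ≠ −3` put `K` in Gross's standing case `D ≠ 3, 4` (`u_K = 1`). [folklore] -/
theorem discr_lt_neg_four_of_odd (hK : IsImaginaryQuadratic K) (hodd : Odd (NumberField.discr K))
    (h3 : NumberField.discr K ≠ -3) : NumberField.discr K < -4 := by
  have hneg : NumberField.discr K < 0 := hK.discr_neg
  rcases Literature.NumberTheory.QuadraticFields.Quadratic.isFundamentalDiscriminant_discr (K := K) hK.1 with
    ⟨h1, -, -⟩ | ⟨h4, -, -⟩
  · omega
  · exfalso
    obtain ⟨k, hk⟩ := hodd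
    omega

/-- **Stub C ⟸ its multi-genus form, per frame.** In the binder frame of the registered stub `stub_genusPrimitivityAtTwo`
of line `genus-supply` (`K` imaginary quadratic with odd `d_K ≠ −3` and the Heegner hypothesis, a parametrisation datum
`Dt`, an orientation `β`, an embedding `ι`): a square-free `n` of Kolyvagin primes at `2` and a datum `d` of conductor `n`
whose MULTI-GENUS point `G⁺(n)` is not `2`-divisible in `E(K[n])` witness the stub's conclusion `P(n) ∉ 2E(K[n])`
(`heegner_exists_two_zsmul_eq_derivedPoint_iff_evenPart_of_kolyvagin`). A future lead may re-cut C along this theorem.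
[cite: GrossLMS1991, §3 (3.5), Prop. 3.7 (1), §4 (4.1)] -/
theorem exists_derivedPoint_not_two_dvd_of_multiGenus [W.IsElliptic] [W.IsGloballyMinimal]
    (hK : IsImaginaryQuadratic K) (hodd : Odd (NumberField.discr K)) (h3 : NumberField.discr K ≠ -3)
    (hH : SatisfiesHeegnerHypothesis (W.conductorNorm ℤ) K)
    (h : ∃ (n : ℕ) (d : KolyvaginHeegnerData Dt β ι n), Squarefree n ∧
      (∀ ℓ ∈ n.primeFactors, Zhang2014.IsKolyvaginPrime (W.conductorNorm ℤ) W K 2 ℓ) ∧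
      ¬ ∃ Q : (W.baseChange (ringClassField K ι n)).toAffine.Point, (2 : ℤ) • Q =
        ∑ s ∈ d.S, pointGalHom W (ringClassField K ι n) s
          (n.primeFactorsList.foldr
            (fun ℓ x ↦ ∑ i ∈ (range (ℓ + 1)).filter (fun i ↦ ¬ Odd i),
              pointGalHom W (ringClassField K ι n) (d.σ ℓ ^ i) x) d.y)) :
    ∃ (n : ℕ) (d : KolyvaginHeegnerData Dt β ι n), Squarefree n ∧
      (∀ ℓ ∈ n.primeFactors, Zhang2014.IsKolyvaginPrime (W.conductorNorm ℤ) W K 2 ℓ) ∧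
      ¬ ∃ Q : (W.baseChange (ringClassField K ι n)).toAffine.Point, (2 : ℤ) • Q = d.derivedPoint := by
  obtain ⟨n, d, hn, hKoly, hG⟩ := h
  exact ⟨n, d, hn, hKoly, fun hP ↦ hG ((heegner_exists_two_zsmul_eq_derivedPoint_iff_evenPart_of_kolyvagin hK
    (discr_lt_neg_four_of_odd hK hodd h3) hH hn hKoly d).mp hP)⟩

/-- **… and conversely**: a `2`-primitive `P(n)` gives a `2`-primitive multi-genus point `G⁺(n)` (same `n`, `d`) — the two
forms of stub C are EQUIVALENT frame by frame. [cite: GrossLMS1991, §3 (3.5), Prop. 3.7 (1), §4 (4.1)] -/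
theorem exists_multiGenus_not_two_dvd_of_derivedPoint [W.IsElliptic] [W.IsGloballyMinimal]
    (hK : IsImaginaryQuadratic K) (hodd : Odd (NumberField.discr K)) (h3 : NumberField.discr K ≠ -3)
    (hH : SatisfiesHeegnerHypothesis (W.conductorNorm ℤ) K)
    (h : ∃ (n : ℕ) (d : KolyvaginHeegnerData Dt β ι n), Squarefree n ∧
      (∀ ℓ ∈ n.primeFactors, Zhang2014.IsKolyvaginPrime (W.conductorNorm ℤ) W K 2 ℓ) ∧
      ¬ ∃ Q : (W.baseChange (ringClassField K ι n)).toAffine.Point, (2 : ℤ) • Q = d.derivedPoint) :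
    ∃ (n : ℕ) (d : KolyvaginHeegnerData Dt β ι n), Squarefree n ∧
      (∀ ℓ ∈ n.primeFactors, Zhang2014.IsKolyvaginPrime (W.conductorNorm ℤ) W K 2 ℓ) ∧
      ¬ ∃ Q : (W.baseChange (ringClassField K ι n)).toAffine.Point, (2 : ℤ) • Q =
        ∑ s ∈ d.S, pointGalHom W (ringClassField K ι n) s
          (n.primeFactorsList.foldr
            (fun ℓ x ↦ ∑ i ∈ (range (ℓ + 1)).filter (fun i ↦ ¬ Odd i),
              pointGalHom W (ringClassField K ι n) (d.σ ℓ ^ i) x) d.y) := by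
  obtain ⟨n, d, hn, hKoly, hP⟩ := h
  exact ⟨n, d, hn, hKoly, fun hG ↦ hP ((heegner_exists_two_zsmul_eq_derivedPoint_iff_evenPart_of_kolyvagin hK
    (discr_lt_neg_four_of_odd hK hodd h3) hH hn hKoly d).mpr hG)⟩

/-! ### §4 (APPEND 2, same seat) The level-`1` case of stub C: `M₀ = 0` needs no Kolyvagin prime -/

/-- **If `y_K = P(1)` is itself not `2`-divisible in `E(K[1])` (McCallum's `M₀ = 0`), stub C holds at level `n = 1`**
with the conductor-`1` datum (`1` is square-free with no prime factors; Gross 1991 §4 «`P_1 = y_K`»; McCallum §5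
Lemma 5.1 at `r = 0`). So the registered stub `stub_genusPrimitivityAtTwo` has content only on the part of the habitat
where `y_K ∈ 2E(K[1])` (`M₀ ≥ 1`; by the Gross–Zagier/BSD heuristics exactly where `Ш(E/K)[2] ≠ 0`, e.g. all of WALL
row 1). [cite: GrossLMS1991, §4 (P_1 = y_K)] [cite: McCallumLMS1991, §5 Lemma 5.1] -/
theorem exists_derivedPoint_not_two_dvd_of_level_one [W.IsGloballyMinimal] (d₁ : KolyvaginHeegnerData Dt β ι 1)
    (h : ¬ ∃ Q : (W.baseChange (ringClassField K ι 1)).toAffine.Point, (2 : ℤ) • Q = d₁.derivedPoint) :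
    ∃ (n : ℕ) (d : KolyvaginHeegnerData Dt β ι n), Squarefree n ∧
      (∀ ℓ ∈ n.primeFactors, Zhang2014.IsKolyvaginPrime (W.conductorNorm ℤ) W K 2 ℓ) ∧
      ¬ ∃ Q : (W.baseChange (ringClassField K ι n)).toAffine.Point, (2 : ℤ) • Q = d.derivedPoint :=
  ⟨1, d₁, squarefree_one, fun ℓ hℓ ↦ absurd hℓ (by rw [Nat.primeFactors_one]; exact Finset.notMem_empty ℓ), h⟩

/-- **The `M₀`-dichotomy for stub C, per frame**: either `M₀ = 0` and C holds at level `1` (previous theorem), or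
`y_K ∈ 2E(K[1])` — the case a worker on C may assume without loss. [cite: McCallumLMS1991, §5 Lemma 5.1] -/
theorem exists_derivedPoint_not_two_dvd_or_two_dvd_derivedPoint_one [W.IsGloballyMinimal]
    (d₁ : KolyvaginHeegnerData Dt β ι 1) :
    (∃ (n : ℕ) (d : KolyvaginHeegnerData Dt β ι n), Squarefree n ∧
      (∀ ℓ ∈ n.primeFactors, Zhang2014.IsKolyvaginPrime (W.conductorNorm ℤ) W K 2 ℓ) ∧
      ¬ ∃ Q : (W.baseChange (ringClassField K ι n)).toAffine.Point, (2 : ℤ) • Q = d.derivedPoint) ∨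
    ∃ Q : (W.baseChange (ringClassField K ι 1)).toAffine.Point, (2 : ℤ) • Q = d₁.derivedPoint := by
  by_cases h : ∃ Q : (W.baseChange (ringClassField K ι 1)).toAffine.Point, (2 : ℤ) • Q = d₁.derivedPoint
  · exact Or.inr h
  · exact Or.inl (exists_derivedPoint_not_two_dvd_of_level_one d₁ h)

end Heegner

end Summit.BirchSwinnertonDyer.BirchSwinnertonDyer.Theorems.GenusKoly

end
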